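import Mathlib.Data.NNReal.Basic
import Literature.Computability.AlgebraicComplexity.MonotoneStructure
import Literature.Computability.AlgebraicComplexity.ArithCircuitProofs
import HarnessLib

/-!
# The structure theorem for monotone arithmetic circuits computing homogeneous polynomials

The homogeneous form of the decomposition theorem behind monotone arithmetic-circuit lower
bounds (Jerrum–Snir 1982 §3, Valiant 1980; in the two-factor form popularised by Yehudayoff 2019
and by Raz–Yehudayoff for multilinear polynomials; the tree's
`Literature.Computability.AlgebraicComplexity.ArithCircuit.exists_balanced_decomposition`
(`MonotoneStructure.lean`) is the set-multilinear ("ordered") variant of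
Chattopadhyay–Datta–Ghosal–Mukhopadhyay 2022, Thm. 2.1): if a monotone fan-in-two circuit of
size `s` over the semiring `ℝ≥0` computes a homogeneous polynomial `p` of degree `n ≥ 3`, then
`p = Σ_t a_t · b_t` with at most `4 s (n+1)²` terms, where each `a_t` is homogeneous of a degree
`d_t` with `n/3 < d_t ≤ 2n/3` and `a_t b_t ≤ p` coefficientwise.

## What is here

* `DepthReduction.SLP.exists_homogeneous_balanced_decomposition` — the theorem for values of
  straight-line programs over `ℝ≥0` (`DepthReduction.SLP` of `GateQuotients.lean`).
* `ArithCircuit.exists_homogeneous_balanced_decomposition` — the same for fan-in-two circuits of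
  the tree's `ArithCircuit ℝ≥0` model (via `DepthReduction.exists_slp`).
* `exists_homogeneous_balanced_decomposition_of_complexity_le` — the same read off the
  complexity measure `complexity p ≤ s` (`complexity` is attained by a fan-in-two circuit).

## Proof

Verbatim the frontier argument of `MonotoneStructure.lean`, minus orderedness: homogenize the
program in degree `n` (`SLP.homogenize`), expand the output along the frontier `F_m`,
`m = ⌊2n/3⌋` (`HomCircuit.val_eq_sum_frontier`):
`p = Σ_{μ ∈ F_m} [p : μ] · [μ_light] · [μ_heavy]`, and put `a_μ := [μ_heavy]` (homogeneous of its
formal degree, `SLP.isHomogeneous_homogenize_val` of `MonotoneStructure.lean`),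
`b_μ := [p : μ] · [μ_light]`. Over `ℝ≥0` nothing cancels, so every term is coefficientwise below
`p`; for a nonzero term the degree `d = deg μ_heavy` of `a_μ ≠ 0` is its formal degree, and
`deg μ = deg μ_light + deg μ_heavy > m ≥ deg μ_heavy ≥ deg μ_light` gives `(m+1)/2 ≤ d ≤ m`, i.e.
`n < 3d` and `3d ≤ 2n`. Terms with `a_μ b_μ = 0` are dropped. Nothing is claimed about `b_t`
beyond the domination (it need not be homogeneous in this bookkeeping; users take homogeneous
components if they need to).

## References

* [CavalarKumarRossman2022] B. P. Cavalar, M. Kumar, B. Rossman, *Monotone circuit lower bounds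
  from robust sunflowers*, Algorithmica 84 (2022), Lemma 4.5 (arXiv v2 numbering; "see Lemma 3.3
  in [RY11]"): the homogeneous two-factor structure lemma as printed.
* [JerrumSnir1982] M. Jerrum, M. Snir, *Some exact complexity results for straight-line
  computations over semirings*, J. ACM 29 (1982), §3.
* [ChattopadhyayDattaGhosalMukhopadhyay2022] §2, Thm. 2.1 (ordered form, attributed to
  Yehudayoff 2019).
* [Tavenas2015] §4–5 (homogenization, frontier identity), via `GateQuotients.lean`.
-/

noncomputable section

namespace Literature.Computability.AlgebraicComplexity

open MvPolynomial
open scoped NNReal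

universe u v

variable {σ : Type v}

/-- Over `ℝ≥0` there is no cancellation: a summand of a finite sum of polynomials is
coefficientwise below the sum (any variable type; private plumbing). [folklore] -/
private theorem coeff_le_coeff_finset_sum {α : Type*} (s : Finset α) (T : α → MvPolynomial σ ℝ≥0)
    {a : α} (ha : a ∈ s) (m : σ →₀ ℕ) :
    coeff m (T a) ≤ coeff m (∑ b ∈ s, T b) := by
  rw [coeff_sum]
  exact Finset.single_le_sum (f := fun b => coeff m (T b)) (fun _ _ => zero_le) ha

section StructureNNReal

open DepthReduction

/-- **Structure theorem for monotone straight-line programs, homogeneous form.** If a value `p`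
of a straight-line program of length `s` over the semiring `ℝ≥0` is homogeneous of degree
`n ≥ 3`, then `p = Σ_t a_t · b_t` with at most `4 s (n+1)²` terms, where `a_t` is homogeneous of
a degree `d_t` with `n < 3 d_t` and `3 d_t ≤ 2 n`, and `a_t b_t ≤ p` coefficientwise (each listed
term is nonzero). Proof: homogenize, expand along the frontier `F_{⌊2n/3⌋}`, take `a_t` = value
of the heavier child of the frontier gate. This is the printed lemma (there: at most `s + 1` terms,
both factors of degree in `[d/3, 2d/3)`, read off parse trees) in the Valiant–Skyum–Berkowitz–Rackoff
bookkeeping of the tree: window `n/3 < deg a_t ≤ 2n/3`, polynomially many terms, domination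
`a_t b_t ≤ p` explicit. [cite: CavalarKumarRossman2022, Lemma 4.5] -/
theorem DepthReduction.SLP.exists_homogeneous_balanced_decomposition (S : SLP ℝ≥0 σ) {i : ℕ}
    (hi : i < S.len) {n : ℕ} (hhom : (S.val i).IsHomogeneous n) (hn : 3 ≤ n) :
    ∃ L : List (ℕ × MvPolynomial σ ℝ≥0 × MvPolynomial σ ℝ≥0),
      L.length ≤ 4 * S.len * (n + 1) ^ 2 ∧
      (L.map fun t => t.2.1 * t.2.2).sum = S.val i ∧
      ∀ t ∈ L, t.2.1.IsHomogeneous t.1 ∧ n < 3 * t.1 ∧ 3 * t.1 ≤ 2 * n ∧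
        t.2.1 * t.2.2 ≠ 0 ∧ ∀ m, coeff m (t.2.1 * t.2.2) ≤ coeff m (S.val i) := by
  classical
  set p := S.val i with hp_def
  -- the homogenized program and the output node
  set H := S.homogenize n with hH
  let α : S.Node n := (⟨i, hi⟩, SLP.Tag.Q (Fin.last n))
  have hval : H.val α = p := by
    change S.hval n (⟨i, hi⟩, SLP.Tag.Q (Fin.last n)) = p
    rw [SLP.hval_Q]
    exact homogeneousComponent_eq_self hhom
  have hdegα : H.deg α = n := rfl
  set m := 2 * n / 3 with hm_def
  have hm1 : 1 ≤ m := by omega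
  have hmn : m < H.deg α := by rw [hdegα]; omega
  have key := H.val_eq_sum_frontier hm1 hmn
  rw [hval] at key
  -- the factors attached to a frontier gate
  let hv : S.Node n → S.Node n := fun μ => H.heavy (H.children μ).1 (H.children μ).2
  let lt : S.Node n → S.Node n := fun μ => H.light (H.children μ).1 (H.children μ).2
  let a : S.Node n → MvPolynomial σ ℝ≥0 := fun μ => H.val (hv μ)
  let b : S.Node n → MvPolynomial σ ℝ≥0 := fun μ => H.quot α μ * H.val (lt μ)
  have hterm : ∀ μ ∈ H.frontier m, H.quot α μ * H.val μ = a μ * b μ := by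
    intro μ hμ
    obtain ⟨hk, -, -, -⟩ := H.of_mem_frontier hμ
    change H.quot α μ * H.val μ = H.val (hv μ) * (H.quot α μ * H.val (lt μ))
    rw [H.val_prod_eq hk]
    ring
  have key' : p = ∑ μ ∈ H.frontier m, a μ * b μ := key.trans (Finset.sum_congr rfl hterm)
  set T := (H.frontier m).filter fun μ => a μ * b μ ≠ 0 with hT
  have hsumT : ∑ μ ∈ T, a μ * b μ = p := by
    rw [hT, Finset.sum_filter_ne_zero, ← key']
  have hle : ∀ μ ∈ T, ∀ mm, coeff mm (a μ * b μ) ≤ coeff mm p := by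
    intro μ hμ mm
    rw [← hsumT]
    exact coeff_le_coeff_finset_sum T (fun μ => a μ * b μ) hμ mm
  -- homogeneity of `a μ` and balance of its degree
  have hahom : ∀ μ, (a μ).IsHomogeneous (H.deg (hv μ)) := fun μ =>
    S.isHomogeneous_homogenize_val n (hv μ)
  have hbal : ∀ μ ∈ T, n < 3 * H.deg (hv μ) ∧ 3 * H.deg (hv μ) ≤ 2 * n := by
    intro μ hμ
    have hμF : μ ∈ H.frontier m := (Finset.mem_filter.1 hμ).1
    obtain ⟨hk, hdμ, h1, h2⟩ := H.of_mem_frontier hμF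
    have hdeg := H.deg_prod_eq hk
    have hll := H.deg_light_le (H.children μ).1 (H.children μ).2
    have hhm := H.deg_heavy_le_of h1 h2
    change H.deg μ = H.deg (lt μ) + H.deg (hv μ) at hdeg
    change H.deg (lt μ) ≤ H.deg (hv μ) at hll
    change H.deg (hv μ) ≤ m at hhm
    omega
  refine ⟨T.toList.map fun μ => (H.deg (hv μ), a μ, b μ), ?_, ?_, ?_⟩
  · rw [List.length_map, Finset.length_toList]
    exact (Finset.card_le_univ T).trans (S.card_node_le n)
  · rw [List.map_map, ← hsumT, ← Finset.sum_map_toList]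
    rfl
  · intro t ht
    obtain ⟨μ, hμ, rfl⟩ := List.mem_map.1 ht
    rw [Finset.mem_toList] at hμ
    exact ⟨hahom μ, (hbal μ hμ).1, (hbal μ hμ).2, (Finset.mem_filter.1 hμ).2, hle μ hμ⟩

/-- **Structure theorem for monotone arithmetic circuits, homogeneous form** (the tree's
`ArithCircuit` over the semiring `ℝ≥0`, fan-in two, size `s` = number of gates): a homogeneous
polynomial of degree `n ≥ 3` computed by such a circuit is a sum of at most `4 s (n+1)²` nonzero
products `a_t b_t` dominated by it, with `a_t` homogeneous of a degree `d_t`, `n/3 < d_t ≤ 2n/3`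
(printed form: `Q = Σ_{i ≤ s} g_i h_i`, `d/3 ≤ deg g_i, deg h_i < 2d/3`, monotone factors; see the
`SLP` version for the differences in bookkeeping). [cite: CavalarKumarRossman2022, Lemma 4.5] -/
theorem ArithCircuit.exists_homogeneous_balanced_decomposition (P : ArithCircuit ℝ≥0 σ)
    (hP : P.IsFanInTwo) {p : MvPolynomial σ ℝ≥0} (hc : P.Computes p) {n : ℕ}
    (hhom : p.IsHomogeneous n) (hn : 3 ≤ n) :
    ∃ L : List (ℕ × MvPolynomial σ ℝ≥0 × MvPolynomial σ ℝ≥0),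
      L.length ≤ 4 * P.size * (n + 1) ^ 2 ∧
      (L.map fun t => t.2.1 * t.2.2).sum = p ∧
      ∀ t ∈ L, t.2.1.IsHomogeneous t.1 ∧ n < 3 * t.1 ∧ 3 * t.1 ≤ 2 * n ∧
        t.2.1 * t.2.2 ≠ 0 ∧ ∀ m, coeff m (t.2.1 * t.2.2) ≤ coeff m p := by
  obtain ⟨S, hlen, h⟩ := DepthReduction.exists_slp P hP
  unfold ArithCircuit.Computes at hc
  rcases h with ⟨i, hi, hval⟩ | ⟨j, hj⟩ | ⟨c, hcC⟩
  · rw [← hc, hval, ← hlen]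
    rw [← hc, hval] at hhom
    exact S.exists_homogeneous_balanced_decomposition hi hhom hn
  · -- the output is a variable: homogeneous of degree `1 ≠ n`
    exfalso
    rw [← hc, hj] at hhom
    have h1 : (X j : MvPolynomial σ ℝ≥0).IsHomogeneous 1 := isHomogeneous_X ℝ≥0 j
    have := IsHomogeneous.inj_right h1 hhom (X_ne_zero j)
    omega
  · by_cases hc0 : c = 0
    · refine ⟨[], by simp, ?_, by simp⟩
      rw [← hc, hcC, hc0]; simp
    · exfalso
      rw [← hc, hcC] at hhom
      have h0 : (C c : MvPolynomial σ ℝ≥0).IsHomogeneous 0 := isHomogeneous_C σ c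
      have := IsHomogeneous.inj_right h0 hhom (by simpa using hc0)
      omega

/-- The structure theorem read off the complexity measure: if `complexity p ≤ s` for a
homogeneous `p` of degree `n ≥ 3` over `ℝ≥0`, then `p` is a sum of at most `4 s (n+1)²` nonzero
balanced dominated products (the printed lemma stated for the complexity measure of the tree,
which is attained by a fan-in-two circuit, `ArithCircuit.exists_computes_size_eq_complexity`).
[cite: CavalarKumarRossman2022, Lemma 4.5] -/
theorem exists_homogeneous_balanced_decomposition_of_complexity_le {p : MvPolynomial σ ℝ≥0}
    {s n : ℕ} (hs : complexity p ≤ s) (hhom : p.IsHomogeneous n) (hn : 3 ≤ n) :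
    ∃ L : List (ℕ × MvPolynomial σ ℝ≥0 × MvPolynomial σ ℝ≥0),
      L.length ≤ 4 * s * (n + 1) ^ 2 ∧
      (L.map fun t => t.2.1 * t.2.2).sum = p ∧
      ∀ t ∈ L, t.2.1.IsHomogeneous t.1 ∧ n < 3 * t.1 ∧ 3 * t.1 ≤ 2 * n ∧
        t.2.1 * t.2.2 ≠ 0 ∧ ∀ m, coeff m (t.2.1 * t.2.2) ≤ coeff m p := by
  obtain ⟨P, h2, hcomp, hsize⟩ := ArithCircuit.exists_computes_size_eq_complexity p
  obtain ⟨L, hL, hsum, hprop⟩ :=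
    ArithCircuit.exists_homogeneous_balanced_decomposition P h2 hcomp hhom hn
  refine ⟨L, hL.trans ?_, hsum, hprop⟩
  rw [hsize]
  exact Nat.mul_le_mul_right _ (Nat.mul_le_mul_left _ hs)

end StructureNNReal

end Literature.Computability.AlgebraicComplexity
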